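import Summits.RiemannHypothesis.RiemannHypothesis.Theorems.SemilocalKinkedWallOffsets
import Summits.RiemannHypothesis.RiemannHypothesis.Theorems.SemilocalClassLaw
import Summits.RiemannHypothesis.RiemannHypothesis.Theorems.SemilocalNegCertTwentyThreeKinked1690Final
import Summits.RiemannHypothesis.RiemannHypothesis.Theorems.SemilocalNegCertTwentyNineKinked1723Final
import Summits.RiemannHypothesis.RiemannHypothesis.Theorems.SemilocalNegCertThirtyOneKinked1812Final
import Summits.RiemannHypothesis.RiemannHypothesis.Theorems.SemilocalNegCertThirtySevenKinked1862Final
import Summits.RiemannHypothesis.RiemannHypothesis.Theorems.SemilocalNegCertFortyOneKinked1886Final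
import Summits.RiemannHypothesis.RiemannHypothesis.Theorems.SemilocalNegCertFortyThreeKinked1931Final
import Summits.RiemannHypothesis.RiemannHypothesis.Theorems.SemilocalNegCertFortySevenKinked1991Final
import Summits.RiemannHypothesis.RiemannHypothesis.Theorems.SemilocalNegCertFiftyThreeKinked2044Final
import Summits.RiemannHypothesis.RiemannHypothesis.Theorems.SemilocalNegCertFiftyNineKinked2061Final
import Summits.RiemannHypothesis.RiemannHypothesis.Theorems.SemilocalNegCertSixtyOneKinked2107Final
import Summits.RiemannHypothesis.RiemannHypothesis.Theorems.SemilocalNegCertSixtySevenKinked2137Final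
import Summits.RiemannHypothesis.RiemannHypothesis.Theorems.SemilocalNegCertSeventyOneKinked2150Final
import HarnessLib

/-!
# The KINKED kernel wall table, part B: `δ*(q) < 0.0071` for every prime `5 ≤ q ≤ 73` (RH-FREE; cell rh-explicit, seat cc-s2-9 gen0/gen2/gen3, D-0074 (D5) WEIL data engine)

RH-FREE (LADDER-RH column WEIL, rung DATA → W-P(P2) «class / locality law instances beyond the inputs of
`SemilocalClassLaw.semilocalClassLawBelow_eighty`»).  HONEST FRAMING: the wall offsets `δ*(q) = a*(S_q) − (log q)/2`
(`HandoffMarginLaw.wallOffset`, `S_q = Nat.primesBelow q`) are numbers of TRUNCATED Weil forms (finitely many places); this file extends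
part A (`SemilocalKinkedWallOffsets`: `5 ≤ q ≤ 23`, seven walls) by the kinked rows `q = 29, 31` (gen0); `q = 37, 41, 43, 47, 53, 59` (gen2); `q = 61, 67, 71, 73` (gen3) (reduced kink sets: slope breaks at the
prime-atom images, resp. the odd-prime images from `q = 53` on).  The SIGN of `δ*(q)` for `q ≥ 7` (= the handoff step `H(q⁻)`) is RH-strength bookkeeping and is NOT
claimed; `δ*(q) → 0` along the primes IS RH (`HandoffWallCeiling.riemannHypothesis_iff_wallOffset_tendsto_zero`).  Nothing here bears on the truth of RH.

THE TABLE (kernel; DATA = certified two-engine walls of SEMILOCAL-TABLE §1 / EXTREMALS for comparison, not used):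
part A: `δ*(5) < 0.0063 · δ*(7) < 0.00705 · δ*(11) < 0.00706 · δ*(13) < 0.0066 · δ*(17) < 0.006245 · δ*(19) < 0.00532 · δ*(23) < 0.0055`;
this file: `δ*(29) < 0.00581` (865/512; DATA 1.1·10⁻⁴) · `δ*(31) < 0.00567` (441/256; DATA 1.1·10⁻⁴) · `δ*(37) < 0.006065` (1855/1024; DATA 7·10⁻⁵) · `δ*(41) < 0.005519` (1907/1024; DATA 6·10⁻⁵) · `δ*(43) < 0.005143` (1931/1024; DATA 6·10⁻⁵) · `δ*(47) < 0.005591` (1977/1024; DATA 5·10⁻⁵) · `δ*(53) < 0.006065` (2039/1024; DATA 4·10⁻⁵) · `δ*(59) < 0.005177` (2093/1024; DATA 3·10⁻⁵) · `δ*(61) < 0.00511` (1055/512; DATA 2.9·10⁻⁵) · `δ*(67) < 0.005076` (1079/512; DATA 2.6·10⁻⁵) · `δ*(71) < 0.005379` (547/256; DATA 2.3·10⁻⁵) · `δ*(73) < 0.005161` (1101/512; DATA 2.3·10⁻⁵);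
hence `∀ q prime, 5 ≤ q ≤ 73 → δ*(q) < 0.0071` (nineteen walls; the polynomial-class rows give `0.0096 … 0.0305` on the same range), and, in the
class-law currency (§4, every finite `S` via first-gap locality `SemilocalClassLaw.weilSemilocalThreshold_eq_primesBelow`):
`5 ≤ q(S) ≤ 73 → a*(S) < (log q(S))/2 + 0.0071`, two-sided `1 ≤ a*(S)` for `q(S) ≥ 11`.  Folklore throughout; no new certificate in this file.
-/

set_option linter.dupNamespace false  -- the mandated namespace repeats `RiemannHypothesis`

noncomputable section

open Set Literature.NumberTheory.LFunctions
open Summit.RiemannHypothesis.RiemannHypothesis.Theorems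
open Summit.RiemannHypothesis.RiemannHypothesis.Theorems.HandoffMarginLaw (wallOffset)
open Summit.RiemannHypothesis.RiemannHypothesis.Theorems.MotivicDoor.SemilocalThreshold
open Summit.RiemannHypothesis.RiemannHypothesis.Theorems.SemilocalPolyWitness

namespace Summit.RiemannHypothesis.RiemannHypothesis.Theorems.SemilocalKinkedWallOffsets

/-! ## §3  The table `5 ≤ q ≤ 73` -/

/-- **THE KINKED KERNEL WALL TABLE through `q = 73`**: `δ*(q) < 0.0071` for every prime `5 ≤ q ≤ 73` (nineteen walls; one-sided, RH-free).
[this cell, HOME/SEMILOCAL-TABLE.md §1; tree certificates] -/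
theorem wallOffset_lt_00071_of_prime_le_seventythree {q : ℕ} (hq : q.Prime) (h5 : 5 ≤ q) (h73 : q ≤ 73) : wallOffset q < 0.0071 := by
  by_cases h23 : q ≤ 23
  · exact wallOffset_lt_00071_of_prime_le hq h5 h23
  push Not at h23
  interval_cases q
  all_goals first
    | exact absurd hq (by decide)
    | linarith [wallOffset_twentynine_lt_000581]
    | linarith [wallOffset_thirtyone_lt_000567]
    | linarith [wallOffset_thirtyseven_lt_006065]
    | linarith [wallOffset_fortyone_lt_005519]
    | linarith [wallOffset_fortythree_lt_005143]
    | linarith [wallOffset_fortyseven_lt_005591]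
    | linarith [wallOffset_fiftythree_lt_006065]
    | linarith [wallOffset_fiftynine_lt_005177]
    | linarith [wallOffset_sixtyone_lt_00511]
    | linarith [wallOffset_sixtyseven_lt_005076]
    | linarith [wallOffset_seventyone_lt_005379]
    | linarith [wallOffset_seventythree_lt_005161]

/-- **Two-sided form for `11 ≤ q ≤ 73`** with the `a = 1` rung: `1 − (log q)/2 ≤ δ*(q) < 0.0071` (the lower end only records that every such
wall is `≥ 1`; the true sign of `δ*(q)` is not claimed). [this cell; tree rung `a = 1`] -/
theorem wallOffset_mem_Ico_of_prime_le_seventythree {q : ℕ} (hq : q.Prime) (h11 : 11 ≤ q) (h73 : q ≤ 73) :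
    wallOffset q ∈ Ico (1 - Real.log q / 2) 0.0071 :=
  ⟨HandoffLadderRungOne.one_sub_log_half_le_wallOffset (by omega), wallOffset_lt_00071_of_prime_le_seventythree hq (by omega) h73⟩

/-- **CLASS form** (the «instances» currency of `SemilocalClassLaw`), stated for `S = S_q`: `a*(S_q) < (log q)/2 + 0.0071` for every prime
`5 ≤ q ≤ 73`; for an arbitrary finite `S` of least missing prime `q` in this range combine with the per-class theorems
`weilSemilocalThreshold_le_<b>_of_mem` of the rows. -/
theorem weilSemilocalThreshold_primesBelow_lt_of_prime_le_seventythree {q : ℕ} (hq : q.Prime) (h5 : 5 ≤ q) (h73 : q ≤ 73) :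
    weilSemilocalThreshold (Nat.primesBelow q) < Real.log q / 2 + 0.0071 := by
  have h := wallOffset_lt_00071_of_prime_le_seventythree hq h5 h73
  rw [wallOffset] at h
  linarith

/-! ## §4  The table in the class-law currency: every finite `S` with `5 ≤ q(S) ≤ 73` -/

open Summit.RiemannHypothesis.RiemannHypothesis.Theorems.SemilocalClassLaw (leastMissingPrime leastMissingPrime_prime
  weilSemilocalThreshold_eq_primesBelow one_le_weilSemilocalThreshold_of_ge_eleven)

/-- **CLASS / LOCALITY INSTANCES, uniform form (RH-free, every finite `S`)**: if the least missing prime `q(S)` of a finite `S ⊆ ℕ`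
satisfies `5 ≤ q(S) ≤ 73`, then `a*(S) < (log q(S))/2 + 0.0071` — first-gap locality (`SemilocalClassLaw.weilSemilocalThreshold_eq_primesBelow`,
the PROVED segment `semilocalClassLawBelow_eighty` of C-I(a)) composed with the kinked wall table.  This is the «instances beyond the inputs of
`semilocalClassLawBelow_eighty`» currency of LADDER-RH W-P(P2): the Below-80 inputs give `a*(S) < (log q(S)⁺)/2` (next prime), the kinked rows pin
`a*(S)` to within `0.0071` above the coincidence point `(log q(S))/2` for nineteen classes. [this cell; tree certificates + `SemilocalClassLaw` §4] -/
theorem weilSemilocalThreshold_lt_of_leastMissingPrime_le_seventythree {S : Finset ℕ} (h5 : 5 ≤ leastMissingPrime S)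
    (h73 : leastMissingPrime S ≤ 73) : weilSemilocalThreshold S < Real.log (leastMissingPrime S) / 2 + 0.0071 := by
  rw [weilSemilocalThreshold_eq_primesBelow (by omega)]
  exact weilSemilocalThreshold_primesBelow_lt_of_prime_le_seventythree (leastMissingPrime_prime S) h5 h73

/-- **Two-sided, every finite `S` with `11 ≤ q(S) ≤ 73`**: `1 ≤ a*(S) < (log q(S))/2 + 0.0071` (lower end: the `a = 1` rung through locality,
`SemilocalClassLaw.one_le_weilSemilocalThreshold_of_ge_eleven`; the RH-conditional lower end `(log q(S))/2 ≤ a*(S)` is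
`SemilocalClassLaw.weilSemilocalThreshold_mem_Ico_of_riemannHypothesis` and is NOT claimed here). [this cell; tree certificates] -/
theorem weilSemilocalThreshold_mem_Ico_of_leastMissingPrime_le_seventythree {S : Finset ℕ} (h11 : 11 ≤ leastMissingPrime S)
    (h73 : leastMissingPrime S ≤ 73) : weilSemilocalThreshold S ∈ Ico (1 : ℝ) (Real.log (leastMissingPrime S) / 2 + 0.0071) :=
  ⟨one_le_weilSemilocalThreshold_of_ge_eleven h11 (by omega), weilSemilocalThreshold_lt_of_leastMissingPrime_le_seventythree (by omega) h73⟩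

end Summit.RiemannHypothesis.RiemannHypothesis.Theorems.SemilocalKinkedWallOffsets

end
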